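import Summits.BirchSwinnertonDyer.BirchSwinnertonDyer.Theorems.ManinLocalTwoThreeManinOddAtFourTwistOrbitMinimal
import HarnessLib

/-!
# Route `ManinLocalTwoThree` (cell `bsd-f2-manin`): crux C2 `ManinOddAtFour` (stmt-BirchSwinnertonDyer-22967)
# REDUCED to the twist-orbit-minimal classes in `χ₋₄`-TWIN NORMAL FORM (`c₆ ≥ 0` whenever a twin exists)

On the twist-orbit-minimal residue of `maninLocalTwoThree_maninOddAtFour_of_twistOrbitMinimal` every class with
`v₂(N) ≥ 5` still comes with its same-level `χ₋₄`-TWIN (the class of `W ⊗ ℚ(√−1)`; cell THEOREM I: the twin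
of the optimal curve is optimal, `c′ = ±c`, `deg′ = deg`, `Δ′ = Δ`), and the two twins are indistinguishable by
(conductor, `|Δ_min|`, degree). The exact additive `χ₋₄`-transport of this seat
(`maninLocalTwoThree_maninConstant_dvd_mul_of_additiveTwist_of_char` + Connell–Pal) also runs at the SAME level:
`c(D_W) ∣ c(D_A)` for any lattice-optimal twin `A` — so Manin's conjecture at `2` need only be proved for ONE
twin of each pair. The sign of `c₆` separates the twins (`c₆(W ⊗ (−1)) = −c₆(W)` up to the even power `u⁻⁶`;
`c₆ = 0` only for `j = 1728`, where the curve is its own twin): clause (vi) of the main theorem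
`maninLocalTwoThree_maninOddAtFour_of_twinNormalForm` lets the residual hypothesis assume `¬ (c₆(W) < 0 ∧` a
lattice-optimal twin with `c₆ > 0` and `|Δ_min| ≤ |Δ_min(W)|` exists`)`. Induction measure:
(level, `2|Δ_min| + [c₆ < 0]`). Census (cell table TWISTCENSUS2, this seat's join; optimal classes
`4 ∣ N ≤ 5·10⁵`): twist-orbit-minimal 259 325 → TWIN NORMAL FORM **224 232**, by `v₂(N)`: `2`: 93 890 · `3`: 95 159
· `4`: 0 · `5`: 23 287 · `6`: 4 200 · `7`: 5 280 · `8`: 2 416 (every `v₂ ≥ 5` stratum halves). A symmetry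
normalisation, not new arithmetic; recorded so that downstream case analyses (Kraus types by `(c₄, c₆)`) may fix
the sign. Nothing here proves BSD or Manin's conjecture. Seat bsd-line-manin23-p2 (gen 2).

References: [Stevens1989] Lemma (5.4); [Pal2012] Prop. 2.4 (Connell), Lemma 3.1; [Cesnavicius2018] Thm. 1.2.
-/

set_option autoImplicit false
set_option linter.dupNamespace false

noncomputable section

open scoped MatrixGroups ModularForm Classical NumberField

namespace Summit.BirchSwinnertonDyer.BirchSwinnertonDyer.Theorems

open CongruenceSubgroup WeierstrassCurve IsDedekindDomain IsDedekindDomain.HeightOneSpectrum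
  Rat.HeightOneSpectrum Literature.NumberTheory.Automorphic
  Literature.NumberTheory.EllipticCurves Literature.NumberTheory.EllipticCurves.ModularForms
  Summit.BirchSwinnertonDyer.Rank1Residual.ManinAdditive

/-! ## §1 `c(D) ∣ c(D')` along an additive `χ₋₄`-twist, explicit partner (any level `N(A) ∣ N`) -/

/-- **Exact divisibility `c(D) ∣ c(D')` along an ADDITIVE `χ₋₄`-twist, explicit partner** (granted
modularity). `W` globally minimal with a lattice-optimal `X₀(N)`-datum `D`, `2⁴ ∣ N`; `A` globally minimal,
additive at `2`, `N(A) ∣ N` (lower OR the same level), with ANY `X₀(N')`-datum `D'`; `W ∼ A ⊗ ℚ(√−1)`. Then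
`c(D) ∣ c(D')` — the engine `maninLocalTwoThree_maninConstant_dvd_mul_of_additiveTwist_of_char` at `χ₄` with
`r = 1`, the Néron clause `Δ(C) = Δ(A)` for the minimal model `C ∼ W` of `A ⊗ (−1)` being Connell–Pal.
[cite: Stevens1989, Lemma (5.4) p. 97] [cite: Pal2012, Prop. 2.4 (Connell), Lemma 3.1] -/
theorem maninLocalTwoThree_maninConstant_dvd_of_additiveTwist_negOne
    (hnf : exists_isNewformOf)
    {W : WeierstrassCurve ℚ} [W.IsElliptic] [W.IsGloballyMinimal] {N : ℕ} [NeZero N]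
    (D : ModularParametrizationData W N)
    (hopt : ∀ z ∈ D.L.lattice, ∃ w ∈ periodLattice D.f, z = D.c * w) (h16 : 2 ^ 4 ∣ N)
    {A : WeierstrassCurve ℚ} [A.IsElliptic] [A.IsGloballyMinimal] {N' : ℕ} [NeZero N']
    (D' : ModularParametrizationData A N')
    (htw : IsIsogenous W (A.quadraticTwist ((-1 : ℤ) : ℚ)))
    (h4A : 2 ^ 2 ∣ A.conductorNorm ℤ) (hAN : A.conductorNorm ℤ ∣ N) :
    D.c ∣ D'.c := by
  haveI : Fact (Nat.Prime 2) := ⟨Nat.prime_two⟩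
  have hd0 : ((-1 : ℤ) : ℚ) ≠ 0 := by norm_num
  haveI : (A.quadraticTwist ((-1 : ℤ) : ℚ)).IsElliptic := A.isElliptic_quadraticTwist hd0
  have hmod : nonempty_modularParametrizationData :=
    nonempty_modularParametrizationData_of_exists_isNewformOf hnf
      IsNewformOf.exists_maninConstant_ne_zero_holds
  have hN : N = W.conductorNorm ℤ :=
    IsNewformOf.level_eq_conductorNorm_of_exists_isNewformOf hnf D.isNewformOf
  have hN' : N' = A.conductorNorm ℤ :=
    IsNewformOf.level_eq_conductorNorm_of_exists_isNewformOf hnf D'.isNewformOf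
  have h4 : 2 ^ 2 ∣ N := dvd_trans (by norm_num) h16
  have hadd : ¬ W.HasGoodReductionAtPrime 2 ∧ ¬ W.HasMultiplicativeReductionAtPrime 2 :=
    not_good_and_not_mult_of_sq_dvd_conductorNorm W (hN ▸ h4)
  have haddA : ¬ A.HasGoodReductionAtPrime 2 ∧ ¬ A.HasMultiplicativeReductionAtPrime 2 :=
    not_good_and_not_mult_of_sq_dvd_conductorNorm A h4A
  -- the minimal model `C` of `A ⊗ (−1)` lies in the class of `W`; Connell–Pal: `Δ(C) = Δ(A)`
  obtain ⟨vC, hvC⟩ := hasGlobalMinimalModel_rat_holds (A.quadraticTwist ((-1 : ℤ) : ℚ))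
  haveI := hvC
  have hCW : IsIsogenous (vC • A.quadraticTwist ((-1 : ℤ) : ℚ)) W :=
    (isIsogenous_of_smul (A.quadraticTwist ((-1 : ℤ) : ℚ)) vC).trans' (IsIsogenous.symm_of_isElliptic htw)
  have h4C : 2 ^ 2 ∣ (vC • A.quadraticTwist ((-1 : ℤ) : ℚ)).conductorNorm ℤ := by
    rw [conductorNorm_eq_of_isIsogenous_of_modularity hmod _ _ hCW, ← hN]
    exact h4
  have hΔC : (vC • A.quadraticTwist ((-1 : ℤ) : ℚ)).Δ = A.Δ :=
    connellPal_Δ_eq_of_negOne_twist_of_four_dvd_conductor_holds A _ vC h4A h4C rfl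
  have hΔ : ((1 : ℤ) : ℚ) ^ 12 * (vC • A.quadraticTwist ((-1 : ℤ) : ℚ)).Δ =
      (((-1 : ℤ) : ℚ)) ^ 6 * A.Δ := by
    rw [hΔC]; norm_num
  have hdvd : D.c ∣ 1 * D'.c :=
    maninLocalTwoThree_maninConstant_dvd_mul_of_additiveTwist_of_char D hopt D' (d := -1)
      (by norm_num) isQuadratic_χ₄_ringHomComp isPrimitive_χ₄_ringHomComp
      (by rw [gaussSum_χ₄_ringHomComp_sq]; norm_num)
      (fun hhalf x ↦ ⟨1, 3, 0, sum_χ₄_modularSymbol_of_half D'.f hhalf x⟩)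
      (fun n hn ↦ by
        rw [show ((-1 : ℤ) : ℚ) = -1 by norm_num, A.LFunction_quadraticTwist_neg_one_apply_of_odd hn,
          Int.cast_mul, χ₄_ringHomComp_apply_natCast])
      (fun n hn ↦ by
        rw [χ₄_ringHomComp_apply_natCast, ZMod.χ₄_nat_eq_if_mod_four, if_pos (Nat.mod_eq_zero_of_dvd hn)]
        simp)
      htw vC rfl hΔ (hN' ▸ hAN) (by simpa using h16) (by rw [hN']; simpa using h4A) haddA hadd
  rwa [one_mul] at hdvd

/-! ## §2 C2 ⟸ Manin at `2` on the twist-orbit-minimal classes in twin normal form -/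

/-- **Crux C2 `ManinOddAtFour` ⟸ Manin's conjecture at `2` on the TWIST-ORBIT-MINIMAL optimal classes in
`χ₋₄`-TWIN NORMAL FORM.** As `maninLocalTwoThree_maninOddAtFour_of_twistOrbitMinimal` (clauses (i)–(v)), with
one more excluded configuration (vi): `c₆(W) < 0` AND a lattice-optimal same-level twin `A` (`W ∼ A ⊗ ℚ(√−1)`,
`A` additive at `2`, `2⁴ ∣ N`, `|Δ_min(A)| ≤ |Δ_min(W)|`) with `c₆(A) > 0` — i.e. on twin pairs the hypothesis
is only needed for the twin with `c₆ ≥ 0`. Induction on (level, `2|Δ_min| + [c₆ < 0]`); the twin step is the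
exact same-level `χ₋₄` divisibility `maninLocalTwoThree_maninConstant_dvd_of_additiveTwist_negOne`. Census:
224 232 of the 897 670 optimal classes with `4 ∣ N ≤ 5·10⁵` remain (`v₂(N)`: 2: 93 890 · 3: 95 159 · 5: 23 287
· 6: 4 200 · 7: 5 280 · 8: 2 416). [cite: Stevens1989, Lemmas (5.2), (5.4)] [cite: Cesnavicius2018, Thm. 1.2]
[cite: Pal2012, Prop. 2.4, Lemma 3.1] -/
theorem maninLocalTwoThree_maninOddAtFour_of_twinNormalForm
    (H : Literature.NumberTheory.EllipticCurves.ModularForms.mazur_not_dvd_maninConstant_of_odd →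
      Literature.NumberTheory.EllipticCurves.ModularForms.abbesUllmo_not_dvd_maninConstant_of_not_dvd_level →
      Literature.NumberTheory.EllipticCurves.ModularForms.cesnavicius_not_two_dvd_maninConstant_of_two_dvd_level →
      Literature.NumberTheory.EllipticCurves.ModularForms.exists_isNewformOf →
      ∀ (W : WeierstrassCurve ℚ) [W.IsElliptic] [W.IsGloballyMinimal] {N : ℕ} [NeZero N]
        (D : ModularParametrizationData W N),
        (∀ z ∈ D.L.lattice, ∃ w ∈ periodLattice D.f, z = D.c * w) → 2 ^ 2 ∣ N →
        ¬ (∃ (W' : WeierstrassCurve ℚ) (d : ℤ), W'.IsElliptic ∧ W'.IsGloballyMinimal ∧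
          (d = -1 ∨ d = 2 ∨ d = -2) ∧ IsIsogenous W (W'.quadraticTwist (d : ℚ)) ∧
          ¬ 2 ^ 2 ∣ W'.conductorNorm ℤ) →
        ¬ (∃ (W' : WeierstrassCurve ℚ) (q : ℕ), W'.IsElliptic ∧ W'.IsGloballyMinimal ∧
          q.Prime ∧ q ≠ 2 ∧ q ^ 2 ∣ N ∧
          IsIsogenous W (W'.quadraticTwist (((-1 : ℤ) ^ (q / 2) * q : ℤ) : ℚ)) ∧
          ¬ q ^ 2 ∣ W'.conductorNorm ℤ) →
        ¬ (∃ (A : WeierstrassCurve ℚ), A.IsElliptic ∧ A.IsGloballyMinimal ∧ 2 ^ 4 ∣ N ∧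
          2 ^ 2 ∣ A.conductorNorm ℤ ∧ A.conductorNorm ℤ ∣ N ∧ A.conductorNorm ℤ < N ∧
          IsIsogenous W (A.quadraticTwist ((-1 : ℤ) : ℚ))) →
        ¬ (∃ (A : WeierstrassCurve ℚ) (_ : A.IsElliptic) (_ : A.IsGloballyMinimal) (N' : ℕ) (_ : NeZero N')
          (D' : ModularParametrizationData A N') (d : ℤ) (C : WeierstrassCurve ℚ) (u : VariableChange ℚ),
          C.IsElliptic ∧ C.IsGloballyMinimal ∧
          (∀ z ∈ D'.L.lattice, ∃ w ∈ periodLattice D'.f, z = D'.c * w) ∧ (d = 2 ∨ d = -2) ∧ 2 ^ 6 ∣ N ∧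
          2 ^ 2 ∣ A.conductorNorm ℤ ∧ A.conductorNorm ℤ ∣ N ∧
          IsIsogenous W (A.quadraticTwist (d : ℚ)) ∧ u • A.quadraticTwist (d : ℚ) = C ∧
          C.Δ = (d : ℚ) ^ 6 * A.Δ ∧
          (A.conductorNorm ℤ < N ∨ A.minimalDiscriminantInt.natAbs < W.minimalDiscriminantInt.natAbs)) →
        ¬ (∃ (A : WeierstrassCurve ℚ) (_ : A.IsElliptic) (_ : A.IsGloballyMinimal)
          (D' : ModularParametrizationData A N) (q : ℕ) (C : WeierstrassCurve ℚ) (u : VariableChange ℚ),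
          C.IsElliptic ∧ C.IsGloballyMinimal ∧
          (∀ z ∈ D'.L.lattice, ∃ w ∈ periodLattice D'.f, z = D'.c * w) ∧ q.Prime ∧ q ≠ 2 ∧ q ^ 2 ∣ N ∧
          IsIsogenous C W ∧ u • A.quadraticTwist (((-1 : ℤ) ^ (q / 2) * q : ℤ) : ℚ) = C ∧
          C.Δ = ((((-1 : ℤ) ^ (q / 2) * q : ℤ)) : ℚ) ^ 6 * A.Δ ∧
          A.minimalDiscriminantInt.natAbs < W.minimalDiscriminantInt.natAbs) →
        ¬ (W.c₆ < 0 ∧ ∃ (A : WeierstrassCurve ℚ) (_ : A.IsElliptic) (_ : A.IsGloballyMinimal)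
          (D' : ModularParametrizationData A N),
          (∀ z ∈ D'.L.lattice, ∃ w ∈ periodLattice D'.f, z = D'.c * w) ∧ 2 ^ 4 ∣ N ∧
          2 ^ 2 ∣ A.conductorNorm ℤ ∧ IsIsogenous W (A.quadraticTwist ((-1 : ℤ) : ℚ)) ∧
          A.minimalDiscriminantInt.natAbs ≤ W.minimalDiscriminantInt.natAbs ∧ 0 < A.c₆) →
        ¬ (2 : ℤ) ∣ D.maninConstant) :
    Summit.BirchSwinnertonDyer.BirchSwinnertonDyer.Theses.ManinLocalTwoThree.ManinOddAtFour := by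
  intro hM hAU hC2 hnf
  suffices key : ∀ (n m : ℕ) (W : WeierstrassCurve ℚ) [W.IsElliptic] [W.IsGloballyMinimal] (N : ℕ)
      [NeZero N] (D : ModularParametrizationData W N), N < n →
      2 * W.minimalDiscriminantInt.natAbs + (if W.c₆ < 0 then 1 else 0) < m →
      (∀ z ∈ D.L.lattice, ∃ w ∈ periodLattice D.f, z = D.c * w) → 2 ^ 2 ∣ N →
      ¬ (2 : ℤ) ∣ D.maninConstant by
    intro W _ _ N _ D hopt h4
    exact key (N + 1) (2 * W.minimalDiscriminantInt.natAbs + (if W.c₆ < 0 then 1 else 0) + 1) W N D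
      (Nat.lt_succ_self N) (Nat.lt_succ_self _) hopt h4
  have hb : ∀ X : WeierstrassCurve ℚ, (if X.c₆ < 0 then 1 else 0) ≤ 1 := fun X ↦ by
    split_ifs <;> omega
  intro n
  induction n with
  | zero => intro m W _ _ N _ D hN; exact absurd hN (Nat.not_lt_zero N)
  | succ n ihN =>
    intro m
    induction m with
    | zero => intro W _ _ N _ D _ hm; exact absurd hm (Nat.not_lt_zero _)
    | succ m ihm =>
    intro W _ _ N _ D hNn hmm hopt h4
    have hN : N = W.conductorNorm ℤ :=
      IsNewformOf.level_eq_conductorNorm_of_exists_isNewformOf hnf D.isNewformOf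
    have hbW := hb W
    -- (i) a dyadic untwist to a class semistable at `2`: closed (twist-covered half)
    by_cases h1 : ∃ (W' : WeierstrassCurve ℚ) (d : ℤ), W'.IsElliptic ∧ W'.IsGloballyMinimal ∧
        (d = -1 ∨ d = 2 ∨ d = -2) ∧ IsIsogenous W (W'.quadraticTwist (d : ℚ)) ∧
        ¬ 2 ^ 2 ∣ W'.conductorNorm ℤ
    · exact maninLocalTwoThree_maninOddAtFour_twistCovered hM hAU hC2 hnf W D hopt h4 h1
    -- (ii) an odd semistable untwist: transport + induction on the level
    by_cases h2 : ∃ (W' : WeierstrassCurve ℚ) (q : ℕ), W'.IsElliptic ∧ W'.IsGloballyMinimal ∧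
        q.Prime ∧ q ≠ 2 ∧ q ^ 2 ∣ N ∧
        IsIsogenous W (W'.quadraticTwist (((-1 : ℤ) ^ (q / 2) * q : ℤ) : ℚ)) ∧
        ¬ q ^ 2 ∣ W'.conductorNorm ℤ
    · obtain ⟨W', q, hE', hM', hqp, hq2, hqN, htw, hqN'⟩ := h2
      haveI := hE'
      haveI := hM'
      haveI : Fact q.Prime := ⟨hqp⟩
      refine maninLocalTwoThree_not_dvd_maninConstant_of_oddUntwist hnf hq2 D hopt hqN htw hqN' ?_
      intro W₁ _ _ N₁ _ D₁ hiso₁ hopt₁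
      have hN₁ : N₁ = W'.conductorNorm ℤ := level_eq_conductorNorm_of_isIsogenous hnf D₁ hiso₁
      have hqNW : q ^ 2 ∣ W.conductorNorm ℤ := hN ▸ hqN
      have hadd : ¬ W.HasGoodReductionAtPrime q ∧ ¬ W.HasMultiplicativeReductionAtPrime q :=
        not_good_and_not_mult_of_sq_dvd_conductorNorm W hqNW
      have hN'N : W'.conductorNorm ℤ ∣ W.conductorNorm ℤ :=
        maninLocalTwoThree_conductorNorm_dvd_of_isIsogenous_twist_pStar hnf hq2 htw hqN' hadd
      have hlt : N₁ < N := by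
        rw [hN₁, hN]
        refine lt_of_le_of_ne (Nat.le_of_dvd (conductorNorm_pos_holds W) hN'N) fun h ↦ hqN' ?_
        rw [h]; exact hqNW
      have h4₁ : 2 ^ 2 ∣ N₁ := by
        rw [hN₁]
        exact maninLocalTwoThree_four_dvd_conductorNorm_of_isIsogenous_twist_pStar hnf hq2 htw (hN ▸ h4)
      exact ihN _ W₁ N₁ D₁ (by omega) (Nat.lt_succ_self _) hopt₁ h4₁
    -- (iii) a `χ₋₄`-untwist to an additive class of lower conductor
    by_cases h3 : ∃ (A : WeierstrassCurve ℚ), A.IsElliptic ∧ A.IsGloballyMinimal ∧ 2 ^ 4 ∣ N ∧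
        2 ^ 2 ∣ A.conductorNorm ℤ ∧ A.conductorNorm ℤ ∣ N ∧ A.conductorNorm ℤ < N ∧
        IsIsogenous W (A.quadraticTwist ((-1 : ℤ) : ℚ))
    · obtain ⟨A, hAe, hAm, h16, h4A, hAN, hlt, htw⟩ := h3
      haveI := hAe
      haveI := hAm
      refine maninLocalTwoThree_not_dvd_maninConstant_of_additiveUntwist_negOne hnf D hopt h16 htw h4A
        hAN ?_
      intro W₁ _ _ N₁ _ D₁ hiso₁ hopt₁
      have hN₁ : N₁ = A.conductorNorm ℤ := level_eq_conductorNorm_of_isIsogenous hnf D₁ hiso₁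
      exact ihN _ W₁ N₁ D₁ (by omega) (Nat.lt_succ_self _) hopt₁ (hN₁ ▸ h4A)
    -- (iv) an aligned `χ±8`-untwist, lower or with smaller `|Δ_min|`
    by_cases h5 : ∃ (A : WeierstrassCurve ℚ) (_ : A.IsElliptic) (_ : A.IsGloballyMinimal) (N' : ℕ)
        (_ : NeZero N') (D' : ModularParametrizationData A N') (d : ℤ) (C : WeierstrassCurve ℚ)
        (u : VariableChange ℚ),
        C.IsElliptic ∧ C.IsGloballyMinimal ∧
        (∀ z ∈ D'.L.lattice, ∃ w ∈ periodLattice D'.f, z = D'.c * w) ∧ (d = 2 ∨ d = -2) ∧ 2 ^ 6 ∣ N ∧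
        2 ^ 2 ∣ A.conductorNorm ℤ ∧ A.conductorNorm ℤ ∣ N ∧
        IsIsogenous W (A.quadraticTwist (d : ℚ)) ∧ u • A.quadraticTwist (d : ℚ) = C ∧
        C.Δ = (d : ℚ) ^ 6 * A.Δ ∧
        (A.conductorNorm ℤ < N ∨ A.minimalDiscriminantInt.natAbs < W.minimalDiscriminantInt.natAbs)
    · obtain ⟨A, hAe, hAm, N', hN'0, D', d, C, u, hCe, hCm, hopt', hd, h64, h4A, hAN, htw, hu, hΔ, hlow⟩ :=
        h5
      haveI := hCe
      haveI := hCm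
      have hN' : N' = A.conductorNorm ℤ :=
        IsNewformOf.level_eq_conductorNorm_of_exists_isNewformOf hnf D'.isNewformOf
      refine maninLocalTwoThree_not_dvd_maninConstant_of_additiveUntwist_two_aligned hnf D hopt h64 hd
        D' htw h4A hAN u hu hΔ ?_
      have h4N' : 2 ^ 2 ∣ N' := hN' ▸ h4A
      have hbA := hb A
      by_cases hlt : A.conductorNorm ℤ < N
      · exact ihN _ A N' D' (by omega) (Nat.lt_succ_self _) hopt' h4N'
      · have hmA : A.minimalDiscriminantInt.natAbs < W.minimalDiscriminantInt.natAbs := hlow.resolve_left hlt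
        have hle : N' ≤ N := hN' ▸ Nat.le_of_dvd (Nat.pos_of_ne_zero (NeZero.ne N)) hAN
        exact ihm A N' D' (by omega) (by omega) hopt' h4N'
    -- (v) an aligned same-level `χ_{q*}`-untwist with smaller `|Δ_min|`
    by_cases h6 : ∃ (A : WeierstrassCurve ℚ) (_ : A.IsElliptic) (_ : A.IsGloballyMinimal)
        (D' : ModularParametrizationData A N) (q : ℕ) (C : WeierstrassCurve ℚ) (u : VariableChange ℚ),
        C.IsElliptic ∧ C.IsGloballyMinimal ∧
        (∀ z ∈ D'.L.lattice, ∃ w ∈ periodLattice D'.f, z = D'.c * w) ∧ q.Prime ∧ q ≠ 2 ∧ q ^ 2 ∣ N ∧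
        IsIsogenous C W ∧ u • A.quadraticTwist (((-1 : ℤ) ^ (q / 2) * q : ℤ) : ℚ) = C ∧
        C.Δ = ((((-1 : ℤ) ^ (q / 2) * q : ℤ)) : ℚ) ^ 6 * A.Δ ∧
        A.minimalDiscriminantInt.natAbs < W.minimalDiscriminantInt.natAbs
    · obtain ⟨A, hAe, hAm, D', q, C, u, hCe, hCm, hopt', hqp, hq2, hqN, hCW, hu, hΔ, hmA⟩ := h6
      haveI := hCe
      haveI := hCm
      haveI : Fact q.Prime := ⟨hqp⟩
      have hadd : ¬ W.HasGoodReductionAtPrime q ∧ ¬ W.HasMultiplicativeReductionAtPrime q :=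
        not_good_and_not_mult_of_sq_dvd_conductorNorm W (hN ▸ hqN)
      refine maninLocalTwoThree_not_dvd_maninConstant_of_untwist_pStar_aligned hq2 D hopt D' dvd_rfl hqN
        hadd u hu hCW hΔ ?_
      have hbA := hb A
      exact ihm A N D' hNn (by omega) hopt' h4
    -- (vi) the twin normal form: `c₆(W) < 0` and a lattice-optimal same-level `χ₋₄`-twin with `c₆ > 0`
    by_cases h7 : W.c₆ < 0 ∧ ∃ (A : WeierstrassCurve ℚ) (_ : A.IsElliptic) (_ : A.IsGloballyMinimal)
        (D' : ModularParametrizationData A N),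
        (∀ z ∈ D'.L.lattice, ∃ w ∈ periodLattice D'.f, z = D'.c * w) ∧ 2 ^ 4 ∣ N ∧
        2 ^ 2 ∣ A.conductorNorm ℤ ∧ IsIsogenous W (A.quadraticTwist ((-1 : ℤ) : ℚ)) ∧
        A.minimalDiscriminantInt.natAbs ≤ W.minimalDiscriminantInt.natAbs ∧ 0 < A.c₆
    · obtain ⟨hW6, A, hAe, hAm, D', hopt', h16, h4A, htw, hle, hA6⟩ := h7
      have hN' : N = A.conductorNorm ℤ :=
        IsNewformOf.level_eq_conductorNorm_of_exists_isNewformOf hnf D'.isNewformOf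
      have hdvd : D.c ∣ D'.c :=
        maninLocalTwoThree_maninConstant_dvd_of_additiveTwist_negOne hnf D hopt h16 D' htw h4A (hN' ▸ dvd_rfl)
      have hbA0 : (if A.c₆ < 0 then 1 else 0) = 0 := if_neg (not_lt.mpr hA6.le)
      have hbW1 : (if W.c₆ < 0 then 1 else 0) = 1 := if_pos hW6
      have hD' : ¬ (2 : ℤ) ∣ D'.c := ihm A N D' hNn (by omega) hopt' h4
      exact fun h ↦ hD' (h.trans hdvd)
    · exact H hM hAU hC2 hnf W D hopt h4 h1 h2 h3 h5 h6 h7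

end Summit.BirchSwinnertonDyer.BirchSwinnertonDyer.Theorems

end
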